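import Summits.CriticalPhenomena.SAWScalingLimit.Theorems.SAWDefectDecoherenceBoundaryClosureRPickEngineWeakDbarSum
import Summits.CriticalPhenomena.SAWScalingLimit.Theorems.SAWDefectDecoherenceBoundaryClosureRHexagonOscillation

/-!
# Pick engine, STAGE 1 (S3) helper: the double cover of the mid-edges by (site, direction)

Support file for crux `BoundaryClosureR` (stmt-CriticalPhenomena-14004), line `pick-half-plane`,
stub `stub_pickEngine`, step (S3) (the lattice identity tying the normalised functional `N_δ` to
the distributional derivative of the developing map).  A developing map `H` lives on the SITES of
`𝕋`; its increments across the `k`-th spoke `s → spoke s k` are the values of `F` on the hexagon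
edge `HexKernel.edge s k` (`potential_spoke`).  To pass from sums over mid-edges (the route's
`N_δ`, `ConjugateClassNegligible`) to sums over `(site, direction) ∈ 𝕋 × Fin 6` one needs the
COVERING LEMMA of this file: every edge of `ℍ` is `HexKernel.edge s k` for EXACTLY TWO pairs,
`(s, k)` and `(spoke s k, k + 3)` (`edge_eq_edge_iff`; written on the oriented endpoints
`face s (![0,2,2,4,4,0] k)` (up) / `face s (![1,1,3,3,5,5] k)` (down) of the edge, `upDown_eq_iff`), whence

  `Σ_{s ∈ T} Σ_{k : Fin 6} g(edge s k) = 2 · Σᶠ_{z ∈ Ω_S} g z`            (`pickEngine_midEdgeCover`)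
  `Σ_{s ∈ T} Σ_k ψ(mid(edge s k)) conj(u_k) F(edge s k) = 2 · (conjugate-class sum)`
                                                                       (`pickEngine_midEdgeCover_conj`)

for every finite set of sites `T` containing all sites at which the summand is non-zero
(`u_k = c_down − c_up ∈ (b, a, c, b, a, c)`, `hexCenter_dn_sub_up`).  Pure lattice combinatorics;
proofs by the fibre decomposition of `(s, k) ↦ (up endpoint, down endpoint)`.
References: Duminil-Copin–Smirnov (2012), §3 (mid-edge sums), folklore.
-/

noncomputable section

open scoped BigOperators ComplexConjugate
open Finset
open Literature.Probability.LatticeModels Literature.Probability.RandomPlanarGeometry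
open Literature.Probability.RandomPlanarGeometry.SAW
open Literature.Barriers.CriticalPhenomena Literature.Barriers.CriticalPhenomena.HexKernel
open Literature.Barriers.CriticalPhenomena.HexGreen
open Summit.CriticalPhenomena.SAWScalingLimit.Theorems.PickHalfPlane

namespace Summit.CriticalPhenomena.SAWScalingLimit.Theorems.PickHalfPlane.Engine

/-! ### The oriented endpoints of the `k`-th hexagon edge -/

/-  Throughout, the UP endpoint of `HexKernel.edge s k` is `face s (![0, 2, 2, 4, 4, 0] k)` and its
    DOWN endpoint is `face s (![1, 1, 3, 3, 5, 5] k)` (the up resp. down face among `face s k`,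
    `face s (k + 1)`); no abbreviation is introduced for them. -/

/-- The oriented endpoints are the two faces of the edge, in one order or the other. [folklore] -/
theorem upIx_dnIx_eq_or (k : Fin 6) :
    (![0, 2, 2, 4, 4, 0] k = k ∧ ![1, 1, 3, 3, 5, 5] k = k + 1) ∨
      (![0, 2, 2, 4, 4, 0] k = k + 1 ∧ ![1, 1, 3, 3, 5, 5] k = k) := by
  fin_cases k <;> simp

/-- `{up endpoint, down endpoint} = edge`. [folklore] -/
theorem mk_up_dn (s : Site 2) (k : Fin 6) :
    s(face s (![0, 2, 2, 4, 4, 0] k), face s (![1, 1, 3, 3, 5, 5] k)) = edge s k := by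
  rcases upIx_dnIx_eq_or k with ⟨h1, h2⟩ | ⟨h1, h2⟩
  · rw [h1, h2]; rfl
  · rw [h1, h2, edge, Sym2.eq_swap]

/-- The up endpoint is an up face. [folklore] -/
theorem up_snd (s : Site 2) (k : Fin 6) : (face s (![0, 2, 2, 4, 4, 0] k)).2 = 0 := by
  fin_cases k <;> rfl

/-- The down endpoint is a neighbour of the up endpoint. [folklore] -/
theorem dn_mem_nbrs_up (s : Site 2) (k : Fin 6) :
    face s (![1, 1, 3, 3, 5, 5] k) ∈ nbrs (face s (![0, 2, 2, 4, 4, 0] k)) := by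
  fin_cases k <;>
    simp [face, nbrs_up, Prod.ext_iff, funext_iff, Fin.forall_fin_two, Pi.single_apply]

/-- **The orientation vectors** `u_k = c(down) − c(up)` of the six edges around a site:
`b, a, c, b, a, c`. [folklore] -/
theorem hexCenter_dn_sub_up (s : Site 2) (k : Fin 6) :
    hexCenter (face s (![1, 1, 3, 3, 5, 5] k)) - hexCenter (face s (![0, 2, 2, 4, 4, 0] k)) =
      ![vecB, vecA, vecC, vecB, vecA, vecC] k := by
  fin_cases k <;>
    (simp [face, hexCenter_mk, HexKernel.triEmbed_sub, vecA, vecB, vecC]; ring)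

/-- `triDiag = e₀ − e₁`. [folklore] -/
theorem triDiag_eq : triDiag = unitE0 - unitE1 := by
  ext i
  fin_cases i <;> simp [triDiag]

/-- Seen from the other end of the spoke the edge keeps its up endpoint … [folklore] -/
theorem up_spoke (s : Site 2) (k : Fin 6) :
    face (spoke s k) (![0, 2, 2, 4, 4, 0] (k + 3)) = face s (![0, 2, 2, 4, 4, 0] k) := by
  fin_cases k <;>
    simp [face, spoke, triDiag_eq, Prod.ext_iff, funext_iff, Fin.forall_fin_two, Pi.single_apply,
      sub_eq_add_neg]

/-- … and its down endpoint. [folklore] -/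
theorem dn_spoke (s : Site 2) (k : Fin 6) :
    face (spoke s k) (![1, 1, 3, 3, 5, 5] (k + 3)) = face s (![1, 1, 3, 3, 5, 5] k) := by
  fin_cases k <;>
    simp [face, spoke, triDiag_eq, Prod.ext_iff, funext_iff, Fin.forall_fin_two, Pi.single_apply,
      sub_eq_add_neg]

/-- `edge (spoke s k) (k + 3) = edge s k`: the two sites of the dual edge see the same hexagon
edge, with opposite indices. [folklore] -/
theorem edge_spoke (s : Site 2) (k : Fin 6) : edge (spoke s k) (k + 3) = edge s k := by
  rw [← mk_up_dn, ← mk_up_dn, up_spoke, dn_spoke]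

/-! ### The covering lemma: exactly two pairs `(site, direction)` per edge -/

/-- **Covering lemma, oriented form.** The oriented endpoint pairs of `(t, j)` and `(s, k)`
coincide iff `(t, j) = (s, k)` or `(t, j) = (spoke s k, k + 3)`. [folklore] -/
theorem upDown_eq_iff (s t : Site 2) (j k : Fin 6) :
    (face t (![0, 2, 2, 4, 4, 0] j) = face s (![0, 2, 2, 4, 4, 0] k) ∧
        face t (![1, 1, 3, 3, 5, 5] j) = face s (![1, 1, 3, 3, 5, 5] k)) ↔
      (t = s ∧ j = k) ∨ (t = spoke s k ∧ j = k + 3) := by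
  constructor
  · rintro ⟨hu, hd⟩
    fin_cases j <;> fin_cases k <;>
      simp [face, spoke, triDiag_eq, Prod.ext_iff, funext_iff, Fin.forall_fin_two,
        Pi.single_apply] at hu hd ⊢ <;> omega
  · rintro (⟨rfl, rfl⟩ | ⟨rfl, rfl⟩)
    · exact ⟨rfl, rfl⟩
    · exact ⟨up_spoke s k, dn_spoke s k⟩

/-- **Covering lemma (set form).** `edge t j = edge s k` iff `(t, j) = (s, k)` or
`(t, j) = (spoke s k, k + 3)`: every hexagon edge is `HexKernel.edge` of exactly two
(site, direction) pairs. [folklore] -/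
theorem edge_eq_edge_iff (s t : Site 2) (j k : Fin 6) :
    edge t j = edge s k ↔ (t = s ∧ j = k) ∨ (t = spoke s k ∧ j = k + 3) := by
  rw [← upDown_eq_iff, ← mk_up_dn, ← mk_up_dn, Sym2.eq_iff]
  constructor
  · rintro (h | ⟨h1, -⟩)
    · exact h
    · exfalso
      have h2 := congrArg Prod.snd h1
      rw [up_snd] at h2
      have h3 := snd_eq_one_of_mem_nbrs (up_snd s k) (dn_mem_nbrs_up s k)
      rw [← h2] at h3
      exact absurd h3 (by decide)
  · exact fun h => Or.inl h

/-- Every up-oriented adjacent pair is an oriented endpoint pair of some `(s, k)`. [folklore] -/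
theorem exists_up_dn_eq {v w : HexVertex} (hv : v.2 = 0) (hw : w ∈ nbrs v) :
    ∃ (s : Site 2) (k : Fin 6),
      face s (![0, 2, 2, 4, 4, 0] k) = v ∧ face s (![1, 1, 3, 3, 5, 5] k) = w := by
  obtain ⟨y, i⟩ := v
  simp only at hv
  subst hv
  rw [nbrs_up] at hw
  simp only [mem_insert, mem_singleton] at hw
  rcases hw with rfl | rfl | rfl
  · exact ⟨y + unitE0, 1, by simp [face], by simp [face]⟩
  · exact ⟨y, 0, rfl, rfl⟩
  · exact ⟨y, 5, rfl, rfl⟩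

/-- Every edge of `ℍ` is some `HexKernel.edge s k`. [folklore] -/
theorem exists_edge_eq_of_adj {v w : HexVertex} (h : hexGraph.Adj v w) :
    ∃ (s : Site 2) (k : Fin 6), s(v, w) = edge s k := by
  rcases snd_eq_zero_or_one v with hv | hv
  · obtain ⟨s, k, hs, hk⟩ := exists_up_dn_eq hv ((mem_nbrs_iff _ _).2 h)
    exact ⟨s, k, by rw [← mk_up_dn, hs, hk]⟩
  · have hw : w.2 = 0 := snd_eq_zero_of_mem_nbrs hv ((mem_nbrs_iff _ _).2 h)
    obtain ⟨s, k, hs, hk⟩ := exists_up_dn_eq hw ((mem_nbrs_iff _ _).2 h.symm)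
    exact ⟨s, k, by rw [← mk_up_dn, hs, hk, Sym2.eq_swap]⟩

/-! ### Reindexing sums: (site, direction) sums are twice the mid-edge sums -/

/-- **Fibre count.** A function of up-oriented pairs, summed over `(s, k) ∈ T × Fin 6` through
the oriented endpoints, is twice its sum over the up-oriented interior pairs of `S` — provided
every pair at which it is non-zero comes from a site of `T` and has both endpoints in `S`.
[folklore] -/
theorem sum_upDown_eq_two_mul_sum_up (S : Finset HexVertex) (T : Finset (Site 2))
    (q : HexVertex → HexVertex → ℂ)
    (hq : ∀ (s : Site 2) (k : Fin 6),
      q (face s (![0, 2, 2, 4, 4, 0] k)) (face s (![1, 1, 3, 3, 5, 5] k)) ≠ 0 →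
      s ∈ T ∧ face s (![0, 2, 2, 4, 4, 0] k) ∈ S ∧ face s (![1, 1, 3, 3, 5, 5] k) ∈ S) :
    ∑ s ∈ T, ∑ k : Fin 6, q (face s (![0, 2, 2, 4, 4, 0] k)) (face s (![1, 1, 3, 3, 5, 5] k)) =
      2 * ∑ v ∈ S.filter (fun v => v.2 = 0), ∑ w ∈ (nbrs v).filter (· ∈ S), q v w := by
  set R : Finset (HexVertex × HexVertex) :=
    ((S.filter fun v => v.2 = 0) ×ˢ S).filter (fun p => p.2 ∈ nbrs p.1) with hR
  set Φ : Site 2 × Fin 6 → HexVertex × HexVertex :=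
    fun x => (face x.1 (![0, 2, 2, 4, 4, 0] x.2), face x.1 (![1, 1, 3, 3, 5, 5] x.2)) with hΦ
  set Q : HexVertex × HexVertex → ℂ := fun p => q p.1 p.2 with hQ
  rw [← Finset.sum_finset_product' R _ _ (mem_upPairs_iff S) (f := q)]
  have hmem : ∀ x : Site 2 × Fin 6, Q (Φ x) ≠ 0 → x.1 ∈ T ∧ Φ x ∈ R := by
    intro x hx
    obtain ⟨hT, hu, hd⟩ := hq x.1 x.2 hx
    exact ⟨hT, (mem_upPairs_iff S _).2
      ⟨mem_filter.2 ⟨hu, up_snd _ _⟩, mem_filter.2 ⟨dn_mem_nbrs_up _ _, hd⟩⟩⟩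
  have hne3 : ∀ k : Fin 6, k ≠ k + 3 := by decide
  calc ∑ s ∈ T, ∑ k : Fin 6, q (face s (![0, 2, 2, 4, 4, 0] k)) (face s (![1, 1, 3, 3, 5, 5] k))
      = ∑ x ∈ T ×ˢ (univ : Finset (Fin 6)), Q (Φ x) := by rw [Finset.sum_product]
    _ = ∑ x ∈ (T ×ˢ (univ : Finset (Fin 6))).filter (fun x => Φ x ∈ R), Q (Φ x) :=
        (Finset.sum_filter_of_ne fun x _ hx => (hmem x hx).2).symm
    _ = ∑ r ∈ R, ∑ x ∈ (T ×ˢ (univ : Finset (Fin 6))).filter (fun x => Φ x = r), Q r :=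
        (Finset.sum_fiberwise_eq_sum_filter' _ _ _ _).symm
    _ = ∑ r ∈ R, 2 * Q r := by
        refine Finset.sum_congr rfl fun r hr => ?_
        rw [Finset.sum_const, nsmul_eq_mul]
        by_cases h0 : Q r = 0
        · rw [h0, mul_zero, mul_zero]
        obtain ⟨hr1, hr2⟩ := (mem_upPairs_iff S r).1 hr
        obtain ⟨s, k, hs, hk⟩ := exists_up_dn_eq (mem_filter.1 hr1).2 (mem_filter.1 hr2).1
        have hΦsk : Φ (s, k) = r := Prod.ext hs hk
        have hΦsk' : Φ (spoke s k, k + 3) = r := by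
          rw [← hΦsk]; exact Prod.ext (up_spoke s k) (dn_spoke s k)
        have hfib : (T ×ˢ (univ : Finset (Fin 6))).filter (fun x => Φ x = r) =
            {(s, k), (spoke s k, k + 3)} := by
          ext x
          simp only [mem_filter, mem_product, mem_univ, and_true, mem_insert, mem_singleton]
          constructor
          · rintro ⟨-, hx⟩
            rw [← hΦsk, hΦ, Prod.mk.injEq] at hx
            rcases (upDown_eq_iff s x.1 x.2 k).1 hx with ⟨h1, h2⟩ | ⟨h1, h2⟩
            · exact Or.inl (Prod.ext h1 h2)
            · exact Or.inr (Prod.ext h1 h2)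
          · rintro (rfl | rfl)
            · exact ⟨(hmem _ (by rwa [hΦsk])).1, hΦsk⟩
            · exact ⟨(hmem _ (by rwa [hΦsk'])).1, hΦsk'⟩
        rw [hfib, Finset.card_pair fun h => hne3 k (congrArg Prod.snd h)]
        norm_num
    _ = 2 * ∑ p ∈ R, q p.1 p.2 := by rw [← Finset.mul_sum]

/-- **Registered sub-goal `pickEngine_midEdgeCover` of stub `stub_pickEngine` (reindexing
form of the covering lemma).** For a finite vertex set `S`, a finite set of sites `T` and any
`g` on mid-edges such that every hexagon edge `edge s k` with `g ≠ 0` has `s ∈ T` and both its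
faces in `S`:  `Σ_{s ∈ T} Σ_{k : Fin 6} g (edge s k) = 2 · Σᶠ_{z ∈ Ω_S} g z` — each mid-edge is
counted once from each end of its dual edge (`edge_eq_edge_iff`). [folklore] -/
theorem pickEngine_midEdgeCover :
    ∀ (S : Finset HexVertex) (T : Finset (Site 2)) (g : Sym2 HexVertex → ℂ),
      (∀ (s : Site 2) (k : Fin 6), g (HexKernel.edge s k) ≠ 0 →
        s ∈ T ∧ HexKernel.face s k ∈ S ∧ HexKernel.face s (k + 1) ∈ S) →
      ∑ s ∈ T, ∑ k : Fin 6, g (HexKernel.edge s k) = 2 * ∑ᶠ z ∈ hexDomainMidEdges S, g z := by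
  intro S T g hg
  have hfaces : ∀ (s : Site 2) (k : Fin 6), g (edge s k) ≠ 0 →
      s ∈ T ∧ face s (![0, 2, 2, 4, 4, 0] k) ∈ S ∧ face s (![1, 1, 3, 3, 5, 5] k) ∈ S := by
    intro s k h
    obtain ⟨hT, h1, h2⟩ := hg s k h
    rcases upIx_dnIx_eq_or k with ⟨hu, hd⟩ | ⟨hu, hd⟩
    · rw [hu, hd]; exact ⟨hT, h1, h2⟩
    · rw [hu, hd]; exact ⟨hT, h2, h1⟩
  rw [finsum_midEdges_eq_sum_up S g ?_]
  · rw [← sum_upDown_eq_two_mul_sum_up S T (fun v w => g s(v, w)) ?_]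
    · exact Finset.sum_congr rfl fun s _ => Finset.sum_congr rfl fun k _ => by rw [mk_up_dn]
    · intro s k h
      rw [mk_up_dn] at h
      exact hfaces s k h
  · intro v w hadj _ hw
    by_contra hne
    obtain ⟨s, k, hsk⟩ := exists_edge_eq_of_adj hadj
    rw [hsk] at hne
    obtain ⟨-, h1, h2⟩ := hg s k hne
    have hw' : w ∈ (s(v, w) : Sym2 HexVertex) := Sym2.mem_mk_right v w
    rw [hsk, edge, Sym2.mem_iff] at hw'
    rcases hw' with rfl | rfl
    · exact hw h1
    · exact hw h2

/-- The same for functions of up-oriented pairs, against the index set of the route's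
conjugate-class sum. [folklore] -/
theorem sum_upDown_eq_two_mul_finsum_pairs (S : Finset HexVertex) (T : Finset (Site 2))
    (f : HexVertex × HexVertex → ℂ)
    (hf : ∀ (s : Site 2) (k : Fin 6), f (face s (![0, 2, 2, 4, 4, 0] k), face s (![1, 1, 3, 3, 5, 5] k)) ≠ 0 →
      s ∈ T ∧ face s (![0, 2, 2, 4, 4, 0] k) ∈ S ∧ face s (![1, 1, 3, 3, 5, 5] k) ∈ S) :
    ∑ s ∈ T, ∑ k : Fin 6, f (face s (![0, 2, 2, 4, 4, 0] k), face s (![1, 1, 3, 3, 5, 5] k)) =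
      2 * ∑ᶠ p ∈ {p : HexVertex × HexVertex | s(p.1, p.2) ∈ hexDomainMidEdges S ∧ p.1.2 = 0},
        f p := by
  rw [finsum_pairs_eq_sum_up S f ?_]
  · exact sum_upDown_eq_two_mul_sum_up S T (fun v w => f (v, w)) hf
  · intro p hp0 hnb _ hnot
    by_contra hne
    obtain ⟨s, k, hs, hk⟩ := exists_up_dn_eq hp0 hnb
    have h' : f (face s (![0, 2, 2, 4, 4, 0] k), face s (![1, 1, 3, 3, 5, 5] k)) ≠ 0 := by rwa [hs, hk]
    obtain ⟨-, h1, h2⟩ := hf s k h'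
    exact hnot ⟨hs ▸ h1, hk ▸ h2⟩

/-- **The conjugate-class sum, reindexed (oriented form of `pickEngine_midEdgeCover`).** With
the orientation vectors `u = (b, a, c, b, a, c)` (`hexCenter_dn_sub_up`):
`Σ_{s ∈ T} Σ_k ψ(mid(edge s k)) · conj u_k · F(edge s k) = 2 · Σᶠ_{p up-oriented, {p} ∈ Ω_S}
ψ(mid p) conj(c_{p.2} − c_{p.1}) F{p}`, for every `ψ` vanishing at the midpoints of the edges
`edge s k` with `s ∉ T` or a face off `S`. [folklore] -/
theorem pickEngine_midEdgeCover_conj :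
    ∀ (S : Finset HexVertex) (T : Finset (Site 2)) (ψ : ℂ → ℂ) (F : Sym2 HexVertex → ℂ),
      (∀ (s : Site 2) (k : Fin 6), ψ (hexMidpoint (HexKernel.edge s k)) ≠ 0 →
        s ∈ T ∧ HexKernel.face s k ∈ S ∧ HexKernel.face s (k + 1) ∈ S) →
      ∑ s ∈ T, ∑ k : Fin 6, ψ (hexMidpoint (HexKernel.edge s k)) *
          conj (![vecB, vecA, vecC, vecB, vecA, vecC] k) * F (HexKernel.edge s k) =
        2 * ∑ᶠ p ∈ {p : HexVertex × HexVertex | s(p.1, p.2) ∈ hexDomainMidEdges S ∧ p.1.2 = 0},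
          ψ (hexMidpoint s(p.1, p.2)) * conj (hexCenter p.2 - hexCenter p.1) * F s(p.1, p.2) := by
  intro S T ψ F hψ
  rw [← sum_upDown_eq_two_mul_finsum_pairs S T
    (fun p => ψ (hexMidpoint s(p.1, p.2)) * conj (hexCenter p.2 - hexCenter p.1) * F s(p.1, p.2))]
  · refine Finset.sum_congr rfl fun s _ => Finset.sum_congr rfl fun k _ => ?_
    simp only [mk_up_dn, hexCenter_dn_sub_up]
  · intro s k h
    simp only [mk_up_dn] at h
    have hψ0 : ψ (hexMidpoint (edge s k)) ≠ 0 := fun h0 => h (by rw [h0, zero_mul, zero_mul])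
    obtain ⟨hT, h1, h2⟩ := hψ s k hψ0
    rcases upIx_dnIx_eq_or k with ⟨hu, hd⟩ | ⟨hu, hd⟩
    · rw [hu, hd]; exact ⟨hT, h1, h2⟩
    · rw [hu, hd]; exact ⟨hT, h2, h1⟩

end Summit.CriticalPhenomena.SAWScalingLimit.Theorems.PickHalfPlane.Engine

end
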